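import Mathlib.Analysis.SpecialFunctions.Pow.Real
import Mathlib.Analysis.Real.Sqrt
import Mathlib.Tactic.Linarith
import Mathlib.Tactic.Ring
import Literature.Combinatorics.Additive.NeumannTPPInequality
import HarnessLib

/-!
# Neumann 2011, Cor. 3.2: the TPP capacity of a group of order `n` is at most
`((1 + √(1 + 8n)) / 4)³`

Topic `Literature/Combinatorics/Additive` (triple product property; companion of
`NeumannTPPInequality.lean` — Observations 2.1 and 3.1 — and `NeumannTPPSubgroupIndex.lean` — §4).

P. M. Neumann, *A note on the triple product property for subsets of finite groups*, LMS J. Comput.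
Math. 14 (2011) 232–237, p. 235, verbatim:

> **Corollary 3.2.** For any finite group `G` (of order `n`, recall) the TPP capacity satisfies
> `β(G) ⩽ ((1 + √(1 + 8n)) / 4)³`.
> *Proof.* Let `(m, p, q)` be the parameters of a TPP triple of subsets of `G` such that `β(G) = mpq`.
> From the proposition, we know that `m(p + q − 1) ⩽ n`, `p(m + q − 1) ⩽ n`, `q(m + p − 1) ⩽ n`.
> Consider the following optimisation problem: for a given real number `d > 3`, find real numbers
> `a, b, c` maximising the product `abc` subject to the six constraints `a ⩾ 1, b ⩾ 1, c ⩾ 1`, and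
> `a(b + c − 1) ⩽ d, b(a + c − 1) ⩽ d, c(a + b − 1) ⩽ d`. I claim that its solution is
> `a = b = c = x`, where `x(2x − 1) = d`. […] We have now shown that if `x` is the positive root of
> the equation `x(2x − 1) = n`, then `β(G) ⩽ x³`. […] Crudely, the corollary tells us that
> `β(G) ⩽ (½ n)^{3/2} + O(n)`, which is a small improvement on the observation by Cohn and Umans
> that `β(G) < n^{3/2}`.

## What is here (all proved; 0 named facts)

* `Neumann2011_cor32_geomMean` — for every TPP triple `(S, T, U)` of a finite group `G`, the
  geometric mean `g = (|S||T||U|)^{1/3}` satisfies `g(2g − 1) ≤ |G|` ("if `x` is the positive root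
  of `x(2x − 1) = n`, then `β(G) ≤ x³`");
* `Neumann2011_cor32` — **Corollary 3.2**: `|S| |T| |U| ≤ ((1 + √(1 + 8|G|)) / 4)³`.

Route.  The printed proof solves the continuous optimisation problem by a smoothing argument
("if `b > c`, then the product `abc` is not maximised").  DEVIATION (recorded): we reach the same
conclusion `g(2g − 1) ≤ n` by one explicit inequality instead — with `a` the largest parameter,
Observation 3.1 gives `n ≥ a(b + c − 1) ≥ 2a√(bc) − a = 2√(a g³) − a` (AM–GM), and
`2√(a g³) − a ≥ 2g² − g` on the whole range `g ≤ a ≤ g³` because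
`4 a g³ − (2g² − g + a)² = (a − g)(g(2g − 1)² − a) ≥ 0` (`Neumann2011.core_ineq`); the maximiser
`a = b = c` of the printed argument is the case `a = g`.  Observation 3.1 itself is the tree's
`TripleProductProperty.card_mul_le_neumann` (`NeumannTPPInequality.lean`).

## References
* P. M. Neumann, LMS J. Comput. Math. 14 (2011) 232–237, doi 10.1112/S1461157010000288: Obs. 3.1
  (p. 234), Cor. 3.2 (p. 235). [Neumann2011]
* H. Cohn, C. Umans, FOCS 2003, arXiv:math/0307321, proof of Lemma 3.1 (`β(G) < n^{3/2}`).
  [CohnUmans2003]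
-/

namespace Literature.Combinatorics.Additive

open Finset

namespace Neumann2011

/-- **The one-variable inequality behind Cor. 3.2** (our route, see the module docstring): for reals
`1 ≤ c, b ≤ a` with `a(b + c − 1) ≤ n`, the geometric mean `g` of `a, b, c` — any real `g ≥ 1` with
`g³ = abc` — satisfies `2g² − g ≤ n`. [cite: Neumann2011, Corollary 3.2 (proof)] -/
theorem core_ineq {a b c g n : ℝ} (hb : 1 ≤ b) (hc : 1 ≤ c) (hba : b ≤ a) (hca : c ≤ a)
    (hg : 1 ≤ g) (hg3 : g ^ 3 = a * b * c) (h : a * (b + c - 1) ≤ n) : 2 * g ^ 2 - g ≤ n := by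
  have ha : 1 ≤ a := hb.trans hba
  have ha0 : 0 ≤ a := by linarith
  have hb0 : 0 ≤ b := by linarith
  have hc0 : 0 ≤ c := by linarith
  have hg0 : 0 ≤ g := by linarith
  -- `g ≤ a ≤ g³`
  have hga : g ≤ a := by
    have h3 : g ^ 3 ≤ a ^ 3 := by
      rw [hg3]
      calc a * b * c ≤ a * a * a := by
            apply mul_le_mul (mul_le_mul_of_nonneg_left hba ha0) hca hc0 (by positivity)
        _ = a ^ 3 := by ring
    exact le_of_pow_le_pow_left₀ (by norm_num) ha0 h3
  have hag : a ≤ g ^ 3 := by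
    rw [hg3]
    have hbc : 1 ≤ b * c := one_le_mul_of_one_le_of_one_le hb hc
    nlinarith
  -- AM–GM: `a (b + c) ≥ √(4 a² b c) = √(4 a g³)`
  have hamgm : Real.sqrt (4 * a * g ^ 3) ≤ a * (b + c) := by
    rw [hg3]
    have e : 4 * a * (a * b * c) ≤ (a * (b + c)) ^ 2 := by nlinarith [sq_nonneg (b - c), sq_nonneg a]
    calc Real.sqrt (4 * a * (a * b * c)) ≤ Real.sqrt ((a * (b + c)) ^ 2) := Real.sqrt_le_sqrt e
      _ = a * (b + c) := Real.sqrt_sq (by positivity)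
  -- the key polynomial inequality `(2g² − g + a)² ≤ 4 a g³`
  have hkey : (2 * g ^ 2 - g + a) ^ 2 ≤ 4 * a * g ^ 3 := by
    have h1 : 0 ≤ (a - g) * (g ^ 3 - a) := mul_nonneg (sub_nonneg.2 hga) (sub_nonneg.2 hag)
    have h2 : 0 ≤ (a - g) * (g * ((3 * g - 1) * (g - 1))) :=
      mul_nonneg (sub_nonneg.2 hga) (mul_nonneg hg0 (mul_nonneg (by linarith) (by linarith)))
    nlinarith [h1, h2]
  have hsq : 2 * g ^ 2 - g + a ≤ Real.sqrt (4 * a * g ^ 3) := by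
    have hnn : 0 ≤ 2 * g ^ 2 - g + a := by nlinarith
    calc 2 * g ^ 2 - g + a = Real.sqrt ((2 * g ^ 2 - g + a) ^ 2) := (Real.sqrt_sq hnn).symm
      _ ≤ Real.sqrt (4 * a * g ^ 3) := Real.sqrt_le_sqrt hkey
  -- assemble: `n ≥ a(b+c−1) = a(b+c) − a ≥ √(4ag³) − a ≥ 2g² − g`
  calc 2 * g ^ 2 - g = (2 * g ^ 2 - g + a) - a := by ring
    _ ≤ Real.sqrt (4 * a * g ^ 3) - a := by linarith
    _ ≤ a * (b + c) - a := by linarith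
    _ = a * (b + c - 1) := by ring
    _ ≤ n := h

/-- From `2g² − g ≤ n` to `g ≤ (1 + √(1 + 8n))/4` (the positive root of `x(2x − 1) = n`).
[cite: Neumann2011, Corollary 3.2 (proof, last display)] -/
theorem le_root_of_two_sq_sub_le {g n : ℝ} (hg : 1 ≤ g) (h : 2 * g ^ 2 - g ≤ n) :
    g ≤ (1 + Real.sqrt (1 + 8 * n)) / 4 := by
  have h1 : 4 * g - 1 ≤ Real.sqrt (1 + 8 * n) := by
    rw [Real.le_sqrt (by linarith) (by nlinarith)]
    nlinarith
  linarith

end Neumann2011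

open Neumann2011

/-- **Neumann 2011, Cor. 3.2 in the form "`β(G) ≤ x³` where `x(2x − 1) = n`"**: for every TPP triple
`(S, T, U)` of subsets of a finite group `G`, the geometric mean `g = (|S| |T| |U|)^{1/3}` satisfies
`2g² − g ≤ |G|`. [cite: Neumann2011, Corollary 3.2] -/
theorem Neumann2011_cor32_geomMean {G : Type*} [Group G] [Fintype G] [DecidableEq G]
    {S T U : Finset G} (h : TripleProductProperty S T U) (hS : S.Nonempty) (hT : T.Nonempty)
    (hU : U.Nonempty) :
    2 * (((S.card * T.card * U.card : ℕ) : ℝ) ^ ((3 : ℕ) : ℝ)⁻¹) ^ 2 -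
        ((S.card * T.card * U.card : ℕ) : ℝ) ^ ((3 : ℕ) : ℝ)⁻¹ ≤ Fintype.card G := by
  -- Observation 3.1, three times, cast to `ℝ`
  have hS1 : 1 ≤ S.card := hS.card_pos
  have hT1 : 1 ≤ T.card := hT.card_pos
  have hU1 : 1 ≤ U.card := hU.card_pos
  have h1 := h.card_mul_le_neumann hS hT hU
  have h2 := h.card_mul_le_neumann₂ hS hT hU
  have h3 := h.card_mul_le_neumann₃ hS hT hU
  set s : ℝ := (S.card : ℝ) with hs
  set t : ℝ := (T.card : ℝ) with ht
  set u : ℝ := (U.card : ℝ) with hu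
  set n : ℝ := (Fintype.card G : ℝ) with hn
  have hs1 : (1 : ℝ) ≤ s := by rw [hs]; exact_mod_cast hS1
  have ht1 : (1 : ℝ) ≤ t := by rw [ht]; exact_mod_cast hT1
  have hu1 : (1 : ℝ) ≤ u := by rw [hu]; exact_mod_cast hU1
  have h1' : s * (t + u - 1) ≤ n := by
    have : ((S.card * (T.card + U.card - 1) : ℕ) : ℝ) ≤ (Fintype.card G : ℝ) := by exact_mod_cast h1
    rw [Nat.cast_mul, Nat.cast_sub (by omega), Nat.cast_add, Nat.cast_one] at this
    simpa [hs, ht, hu, hn] using this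
  have h2' : t * (u + s - 1) ≤ n := by
    have : ((T.card * (U.card + S.card - 1) : ℕ) : ℝ) ≤ (Fintype.card G : ℝ) := by exact_mod_cast h2
    rw [Nat.cast_mul, Nat.cast_sub (by omega), Nat.cast_add, Nat.cast_one] at this
    simpa [hs, ht, hu, hn] using this
  have h3' : u * (s + t - 1) ≤ n := by
    have : ((U.card * (S.card + T.card - 1) : ℕ) : ℝ) ≤ (Fintype.card G : ℝ) := by exact_mod_cast h3
    rw [Nat.cast_mul, Nat.cast_sub (by omega), Nat.cast_add, Nat.cast_one] at this
    simpa [hs, ht, hu, hn] using this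
  -- the geometric mean
  set P : ℝ := ((S.card * T.card * U.card : ℕ) : ℝ) with hP
  have hPstu : P = s * t * u := by simp [hP, hs, ht, hu, Nat.cast_mul]
  have hP1 : 1 ≤ P := by
    rw [hPstu]; exact one_le_mul_of_one_le_of_one_le (one_le_mul_of_one_le_of_one_le hs1 ht1) hu1
  have hP0 : 0 ≤ P := by linarith
  set g : ℝ := P ^ ((3 : ℕ) : ℝ)⁻¹ with hgdef
  have hg3 : g ^ 3 = P := Real.rpow_inv_natCast_pow hP0 (by norm_num)
  have hg1 : 1 ≤ g := Real.one_le_rpow hP1 (by positivity)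
  -- case analysis on the largest parameter
  rcases le_total t s with hts | hst
  · rcases le_total u s with hus | hsu
    · -- `s` largest
      exact core_ineq ht1 hu1 hts hus hg1 (by rw [hg3, hPstu]) h1'
    · -- `u` largest
      exact core_ineq hs1 ht1 hsu (hts.trans hsu) hg1 (by rw [hg3, hPstu]; ring) h3'
  · rcases le_total u t with hut | htu
    · -- `t` largest
      exact core_ineq hu1 hs1 hut hst hg1 (by rw [hg3, hPstu]; ring) h2'
    · -- `u` largest
      exact core_ineq hs1 ht1 (hst.trans htu) htu hg1 (by rw [hg3, hPstu]; ring) h3'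

/-- **Neumann 2011, Corollary 3.2**: for any finite group `G` of order `n` and any TPP triple
`(S, T, U)` of subsets of `G`, `|S| |T| |U| ≤ ((1 + √(1 + 8n)) / 4)³` — i.e. the TPP capacity
satisfies `β(G) ≤ ((1 + √(1 + 8n))/4)³ = (½n)^{3/2} + O(n)`, refining Cohn–Umans' `β(G) < n^{3/2}`.
[cite: Neumann2011, Corollary 3.2] -/
theorem Neumann2011_cor32 {G : Type*} [Group G] [Fintype G] [DecidableEq G] {S T U : Finset G}
    (h : TripleProductProperty S T U) :
    ((S.card * T.card * U.card : ℕ) : ℝ) ≤ ((1 + Real.sqrt (1 + 8 * Fintype.card G)) / 4) ^ 3 := by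
  have hx0 : 0 ≤ (1 + Real.sqrt (1 + 8 * (Fintype.card G : ℝ))) / 4 := by positivity
  rcases S.eq_empty_or_nonempty with hS | hS
  · simp only [hS, Finset.card_empty, zero_mul, Nat.cast_zero]; positivity
  rcases T.eq_empty_or_nonempty with hT | hT
  · simp only [hT, Finset.card_empty, mul_zero, zero_mul, Nat.cast_zero]; positivity
  rcases U.eq_empty_or_nonempty with hU | hU
  · simp only [hU, Finset.card_empty, mul_zero, Nat.cast_zero]; positivity
  have hmain := Neumann2011_cor32_geomMean h hS hT hU
  set P : ℝ := ((S.card * T.card * U.card : ℕ) : ℝ) with hP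
  have hP1 : 1 ≤ P := by
    rw [hP]; exact_mod_cast one_le_mul_of_one_le_of_one_le
      (one_le_mul_of_one_le_of_one_le hS.card_pos hT.card_pos) hU.card_pos
  have hP0 : 0 ≤ P := by linarith
  set g : ℝ := P ^ ((3 : ℕ) : ℝ)⁻¹ with hgdef
  have hg3 : g ^ 3 = P := Real.rpow_inv_natCast_pow hP0 (by norm_num)
  have hg1 : 1 ≤ g := Real.one_le_rpow hP1 (by positivity)
  have hgx : g ≤ (1 + Real.sqrt (1 + 8 * (Fintype.card G : ℝ))) / 4 :=
    le_root_of_two_sq_sub_le hg1 hmain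
  calc P = g ^ 3 := hg3.symm
    _ ≤ ((1 + Real.sqrt (1 + 8 * (Fintype.card G : ℝ))) / 4) ^ 3 :=
        pow_le_pow_left₀ (by linarith) hgx 3

end Literature.Combinatorics.Additive
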